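import Literature.Algebra.Module.CompositionMultiplicity
import Mathlib.Algebra.DirectSum.Module
import Mathlib.Data.ENat.BigOperators
import Mathlib.RingTheory.Noetherian.Basic
import HarnessLib

/-!
# Composition factor multiplicities and lengths of finite direct sums: `[⊕ᵢ Mᵢ : S] = Σᵢ [Mᵢ : S]`, `ℓ(⊕ᵢ Mᵢ) = Σᵢ ℓ(Mᵢ)`
# (Berrick–Keating Thm. 4.1.12; Knapp–Vogan App. A §3 Cor. A.27)

Family `hodge`, lane `lit-hodgefound` (foundations library; seat `lit-hodgefound-p39`, generation 33, row g33-#9); topic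
`Algebra/Module`, namespace `Literature.Algebra.Module.JordanHoelder` (continued).  Sequel of `CompositionMultiplicity` (g33-#1/#7:
`compMult R M S = [M : S]`, `compMult_prod`, `compMult_congr_left`, `compMult_eq_add_of_exact`, `length_eq_sum_compMult`) over an
ARBITRARY ring `R`: the multiplicity type `mult(M) = ([M : S])_S` is «additive on short exact sequences» (Berrick–Keating Thm. 4.1.12 (ii)),
hence additive on FINITE DIRECT SUMS — external (`M × N`, `Π i, T i`, `⨁ i, T i` over a `Fintype`) and internal
(`DirectSum.IsInternal A` for a family `A : ι → Submodule R M` with finitely many non-zero members) — and so is Mathlib's `Module.length`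
(Mathlib has `Module.length_prod`, `Module.length_pi_of_fintype`; the direct-sum and internal forms are added here).  This is the
bookkeeping used to compute multiplicities component-wise in a primary decomposition `M = ⊕_χ P_χ(M)` (Knapp–Vogan Prop. 7.20).
Theorems only, 0 `sorry`, no named fact (net debt 0, D-0026).

## The sources

A. J. Berrick, M. E. Keating, *An Introduction to Rings and Modules* (2000) [BerrickKeating2000, §4.1.11, Thm. 4.1.12 (i)–(ii), p. 135]:
«(i) `M` has a composition series if and only if both `M′` and `M″` have composition series. (ii) … `mult(M) = mult(M′) + mult(M″)`»;
A. W. Knapp, D. A. Vogan (1995) [KnappVogan1995, App. A §3 Cor. A.27, §4 (A.29)] (Jordan–Hölder; the length is additive).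

## What is formalised

* §1 finite length of `M × N`, `Π i, T i`, `⨁ i, T i` (`Fintype ι`): `isFiniteLength_prod(_iff)`, `isFiniteLength_pi_iff`,
  `isFiniteLength_directSum_iff`; `Module.length` of `⨁ i, T i`: `length_directSum_of_fintype`.
* §2 **`compMult_pi_of_fintype : [Π i, T i : S] = Σ i, [T i : S]`**, **`compMult_directSum_of_fintype`** (all `T i` of finite length;
  Mathlib's `Fintype.induction_empty_option` pattern of `Module.length_pi_of_fintype`).
* §3 internal direct sums `DirectSum.IsInternal A`, `A : ι → Submodule R M`: **`length_eq_sum_of_isInternal : ℓ(M) = Σ i, ℓ(A i)`**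
  (`Fintype ι`), `length_eq_sum_of_isInternal_finset` (any finset containing the non-zero members), `length_eq_sum_of_isInternal_of_finite`;
  **`compMult_eq_sum_of_isInternal : [M : S] = Σ i, [A i : S]`** and its `_finset` / `_of_finite` forms; `isFiniteLength_iff_of_isInternal`;
  `finite_ne_bot_of_iSupIndep` (a module of finite length has only finitely many non-zero members in an independent family) and the
  hypothesis-free-index forms `compMult_eq_sum_of_isInternal'`, `length_eq_sum_of_isInternal'` for `M` of finite length.
* §4 `one_le_length_of_ne_bot`, `card_toFinset_ne_bot_le_length`(′), `card_filter_ne_bot_le_length`: the number of non-zero members of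
  an internal direct sum decomposition of `M` is at most `ℓ(M)`.

## Mathlib / Literature search

Mathlib: `Module.length_prod`, `Module.length_pi_of_fintype`, `LinearEquiv.length_eq`, `Module.length_bot`, `Module.length_ne_top_iff`,
`DirectSum.linearEquivFunOnFintype`, `DirectSum.coeLinearMap` + `LinearEquiv.ofBijective` (internal = external), `DirectSum.isInternal_ne_bot_iff`,
`Submodule.finite_ne_bot_of_iSupIndep`, `LinearEquiv.piCongrLeft`, `LinearEquiv.piOptionEquivProd`; no `Module.length` lemma for `DirectSum` /
`IsInternal` (`rg "length.*IsInternal|IsInternal.*length" Mathlib` → nothing).  Literature: g33-#1/#7 `JordanHoelder.compMult*`.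

## References

* A. J. Berrick, M. E. Keating, *An Introduction to Rings and Modules with K-theory in view*, Cambridge Stud. Adv. Math. 65, CUP (2000),
  §4.1.11, Thm. 4.1.12. [BerrickKeating2000]
* A. W. Knapp, D. A. Vogan, *Cohomological Induction and Unitary Representations*, Princeton (1995), App. A §3 Cor. A.27, §4. [KnappVogan1995]
-/

namespace Literature.Algebra.Module

namespace JordanHoelder

open DirectSum

variable {R : Type*} [Ring R] {M : Type*} [AddCommGroup M] [Module R M]
  {N : Type*} [AddCommGroup N] [Module R N]
  (S : Type*) [AddCommGroup S] [Module R S]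

/-! ## §1 Finite length of binary products, finite products and finite direct sums -/

/-- `M × N` has finite length when `M` and `N` do. [cite: BerrickKeating2000, Thm. 4.1.12 (i)] -/
theorem isFiniteLength_prod (hM : IsFiniteLength R M) (hN : IsFiniteLength R N) : IsFiniteLength R (M × N) := by
  rw [isFiniteLength_iff_isNoetherian_isArtinian] at hM hN ⊢
  obtain ⟨_, _⟩ := hM
  obtain ⟨_, _⟩ := hN
  exact ⟨inferInstance, inferInstance⟩

/-- `M × N` has finite length iff `M` and `N` do («`M` has a composition series if and only if both `M′` and `M″` have»).
[cite: BerrickKeating2000, Thm. 4.1.12 (i)] -/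
theorem isFiniteLength_prod_iff : IsFiniteLength R (M × N) ↔ IsFiniteLength R M ∧ IsFiniteLength R N :=
  ⟨fun h => ⟨isFiniteLength_of_injective (LinearMap.inl R M N) LinearMap.inl_injective h,
      isFiniteLength_of_injective (LinearMap.inr R M N) LinearMap.inr_injective h⟩,
    fun h => isFiniteLength_prod h.1 h.2⟩

/-- A FINITE product `Π i, T i` has finite length iff every `T i` does. [cite: BerrickKeating2000, Thm. 4.1.12 (i)] -/
theorem isFiniteLength_pi_iff {ι : Type*} [Fintype ι] (T : ι → Type*) [∀ i, AddCommGroup (T i)] [∀ i, Module R (T i)] :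
    IsFiniteLength R (Π i, T i) ↔ ∀ i, IsFiniteLength R (T i) := by
  simp only [← Module.length_ne_top_iff, Module.length_pi_of_fintype, ne_eq, ENat.sum_eq_top, Finset.mem_univ, true_and,
    not_exists]

/-- `ℓ(⨁ i, T i) = Σ i, ℓ(T i)` for a finite index type (Mathlib's `Module.length_pi_of_fintype` through
`DirectSum.linearEquivFunOnFintype`). [cite: BerrickKeating2000, Thm. 4.1.12 (ii)] [cite: KnappVogan1995, App. A §3 Cor. A.27] -/
theorem length_directSum_of_fintype {ι : Type*} [Fintype ι] [DecidableEq ι] (T : ι → Type*) [∀ i, AddCommGroup (T i)]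
    [∀ i, Module R (T i)] : Module.length R (⨁ i, T i) = ∑ i, Module.length R (T i) := by
  rw [(DirectSum.linearEquivFunOnFintype R ι T).length_eq, Module.length_pi_of_fintype]

/-- A FINITE direct sum `⨁ i, T i` has finite length iff every `T i` does. [cite: BerrickKeating2000, Thm. 4.1.12 (i)] -/
theorem isFiniteLength_directSum_iff {ι : Type*} [Fintype ι] [DecidableEq ι] (T : ι → Type*) [∀ i, AddCommGroup (T i)]
    [∀ i, Module R (T i)] : IsFiniteLength R (⨁ i, T i) ↔ ∀ i, IsFiniteLength R (T i) := by
  rw [← isFiniteLength_pi_iff]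
  exact ⟨fun h => isFiniteLength_of_linearEquiv (DirectSum.linearEquivFunOnFintype R ι T) h,
    fun h => isFiniteLength_of_linearEquiv (DirectSum.linearEquivFunOnFintype R ι T).symm h⟩

/-! ## §2 Multiplicities of finite products and finite (external) direct sums -/

/-- Plumbing for `compMult_pi_of_fintype`: the statement quantified over the index type, proved along Mathlib's
`Fintype.induction_empty_option` exactly as `Module.length_pi_of_fintype`. [cite: BerrickKeating2000, Thm. 4.1.12 (ii)] -/
private theorem compMult_pi_aux : ∀ {ι : Type*} [Fintype ι] (T : ι → Type*) [∀ i, AddCommGroup (T i)] [∀ i, Module R (T i)],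
    (∀ i, IsFiniteLength R (T i)) → compMult R (Π i, T i) S = ∑ i, compMult R (T i) S := by
  apply Fintype.induction_empty_option
  · intro α β _ e IH T _ _ hT
    let _ : Fintype α := .ofEquiv β e.symm
    rw [← compMult_congr_left S (LinearEquiv.piCongrLeft R T e), IH (fun a => T (e a)) (fun a => hT (e a)),
      e.sum_comp (fun b => compMult R (T b) S)]
  · intro T _ _ _
    rw [compMult_of_subsingleton S, Fintype.sum_empty]
  · intro ι _ IH T _ _ hT
    rw [compMult_congr_left S (LinearEquiv.piOptionEquivProd R), compMult_prod S (hT none)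
      ((isFiniteLength_pi_iff _).mpr fun i => hT (some i)), IH (fun i => T (some i)) (fun i => hT (some i)), Fintype.sum_option]

/-- **`[Π i, T i : S] = Σ i, [T i : S]`** for a finite family of modules of finite length — the multiplicity type is additive on
(split) short exact sequences, hence on finite products. [cite: BerrickKeating2000, Thm. 4.1.12 (ii)] [cite: KnappVogan1995, App. A §3 Cor. A.27] -/
theorem compMult_pi_of_fintype {ι : Type*} [Fintype ι] (T : ι → Type*) [∀ i, AddCommGroup (T i)] [∀ i, Module R (T i)]
    (hT : ∀ i, IsFiniteLength R (T i)) : compMult R (Π i, T i) S = ∑ i, compMult R (T i) S :=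
  compMult_pi_aux S T hT

/-- **`[⨁ i, T i : S] = Σ i, [T i : S]`** for a finite (external) direct sum of modules of finite length.
[cite: BerrickKeating2000, Thm. 4.1.12 (ii)] [cite: KnappVogan1995, App. A §3 Cor. A.27] -/
theorem compMult_directSum_of_fintype {ι : Type*} [Fintype ι] [DecidableEq ι] (T : ι → Type*) [∀ i, AddCommGroup (T i)]
    [∀ i, Module R (T i)] (hT : ∀ i, IsFiniteLength R (T i)) :
    compMult R (⨁ i, T i) S = ∑ i, compMult R (T i) S := by
  rw [compMult_congr_left S (DirectSum.linearEquivFunOnFintype R ι T), compMult_pi_of_fintype S T hT]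

/-- Each factor is counted: `[T i : S] ≤ [Π i, T i : S]` when the product has finite length (a factor embeds as a submodule).
[cite: BerrickKeating2000, Thm. 4.1.12 (ii)] -/
theorem compMult_le_compMult_pi {ι : Type*} [DecidableEq ι] (T : ι → Type*) [∀ i, AddCommGroup (T i)]
    [∀ i, Module R (T i)] (h : IsFiniteLength R (Π i, T i)) (i : ι) : compMult R (T i) S ≤ compMult R (Π i, T i) S :=
  compMult_le_of_injective S h (LinearMap.single R (φ := T) i) (Pi.single_injective (M := T) i)

/-! ## §3 Internal direct sums `M = ⊕ i, A i` of submodules -/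

section Internal

variable {ι : Type*} [DecidableEq ι] (A : ι → Submodule R M)

/-- A zero submodule contributes nothing: `[A : S] = 0` for `A = 0`. [cite: BerrickKeating2000, §4.1.11] -/
theorem compMult_eq_zero_of_eq_bot {K : Submodule R M} (hK : K = ⊥) : compMult R K S = 0 := by
  subst hK
  exact compMult_of_subsingleton S

/-- A zero submodule has finite length. [cite: BerrickKeating2000, Thm. 4.1.12 (i)] -/
theorem isFiniteLength_of_eq_bot {K : Submodule R M} (hK : K = ⊥) : IsFiniteLength R K := by
  subst hK
  rw [← Module.length_ne_top_iff, Module.length_bot]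
  exact ENat.zero_ne_top

/-- **`ℓ(M) = Σ i, ℓ(A i)` for an internal direct sum `M = ⊕ i, A i` over a finite index type.**
[cite: BerrickKeating2000, Thm. 4.1.12 (ii)] [cite: KnappVogan1995, App. A §3 Cor. A.27] -/
theorem length_eq_sum_of_isInternal [Fintype ι] (h : DirectSum.IsInternal A) :
    Module.length R M = ∑ i, Module.length R (A i) := by
  rw [← (LinearEquiv.ofBijective (DirectSum.coeLinearMap A) h).length_eq, length_directSum_of_fintype]

/-- `M = ⊕ i, A i` (finite index type) has finite length iff every `A i` does. [cite: BerrickKeating2000, Thm. 4.1.12 (i)] -/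
theorem isFiniteLength_iff_of_isInternal [Fintype ι] (h : DirectSum.IsInternal A) :
    IsFiniteLength R M ↔ ∀ i, IsFiniteLength R (A i) := by
  rw [← isFiniteLength_directSum_iff]
  exact ⟨fun hM => isFiniteLength_of_linearEquiv (LinearEquiv.ofBijective (DirectSum.coeLinearMap A) h).symm hM,
    fun hM => isFiniteLength_of_linearEquiv (LinearEquiv.ofBijective (DirectSum.coeLinearMap A) h) hM⟩

/-- **`[M : S] = Σ i, [A i : S]` for an internal direct sum `M = ⊕ i, A i` over a finite index type** (all `A i` of finite length,
equivalently `M` of finite length). [cite: BerrickKeating2000, Thm. 4.1.12 (ii)] [cite: KnappVogan1995, App. A §3 Cor. A.27] -/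
theorem compMult_eq_sum_of_isInternal [Fintype ι] (h : DirectSum.IsInternal A) (hA : ∀ i, IsFiniteLength R (A i)) :
    compMult R M S = ∑ i, compMult R (A i) S := by
  rw [← compMult_congr_left S (LinearEquiv.ofBijective (DirectSum.coeLinearMap A) h), compMult_directSum_of_fintype S _ hA]

/-- The same with the hypothesis on `M`. [cite: BerrickKeating2000, Thm. 4.1.12 (ii)] -/
theorem compMult_eq_sum_of_isInternal_of_isFiniteLength [Fintype ι] (h : DirectSum.IsInternal A) (hM : IsFiniteLength R M) :
    compMult R M S = ∑ i, compMult R (A i) S :=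
  compMult_eq_sum_of_isInternal S A h fun i => isFiniteLength_submodule (A i) hM

/-- Restricting an internal direct sum decomposition to a finset `s` of indices containing all the non-zero members keeps it an internal
direct sum decomposition (Mathlib's `DirectSum.isInternal_ne_bot_iff`, re-indexed). [cite: KnappVogan1995, App. A §3] -/
theorem isInternal_restrict_finset (h : DirectSum.IsInternal A) (s : Finset ι) (hs : ∀ i, A i ≠ ⊥ → i ∈ s) :
    DirectSum.IsInternal fun i : s => A i := by
  rw [DirectSum.isInternal_submodule_iff_iSupIndep_and_iSup_eq_top] at h ⊢
  refine ⟨h.1.comp Subtype.val_injective, ?_⟩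
  rw [eq_top_iff, ← h.2, iSup_le_iff]
  intro i
  by_cases hi : A i = ⊥
  · rw [hi]
    exact bot_le
  · exact le_iSup (fun j : s => A j) ⟨i, hs i hi⟩

/-- **`ℓ(M) = Σ_{i ∈ s} ℓ(A i)`** for an internal direct sum `M = ⊕ i, A i` and ANY finset `s` of indices containing the non-zero members
(no finiteness hypothesis on the modules). [cite: BerrickKeating2000, Thm. 4.1.12 (ii)] [cite: KnappVogan1995, App. A §3 Cor. A.27] -/
theorem length_eq_sum_of_isInternal_finset (h : DirectSum.IsInternal A) (s : Finset ι) (hs : ∀ i, A i ≠ ⊥ → i ∈ s) :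
    Module.length R M = ∑ i ∈ s, Module.length R (A i) := by
  rw [← Finset.sum_coe_sort]
  exact length_eq_sum_of_isInternal (fun i : s => A i) (isInternal_restrict_finset A h s hs)

/-- **`[M : S] = Σ_{i ∈ s} [A i : S]`** for an internal direct sum `M = ⊕ i, A i` and any finset `s` of indices containing the non-zero
members, all of finite length. [cite: BerrickKeating2000, Thm. 4.1.12 (ii)] [cite: KnappVogan1995, App. A §3 Cor. A.27] -/
theorem compMult_eq_sum_of_isInternal_finset (h : DirectSum.IsInternal A) (s : Finset ι) (hs : ∀ i, A i ≠ ⊥ → i ∈ s)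
    (hA : ∀ i ∈ s, IsFiniteLength R (A i)) : compMult R M S = ∑ i ∈ s, compMult R (A i) S := by
  rw [← Finset.sum_coe_sort]
  exact compMult_eq_sum_of_isInternal S (fun i : s => A i) (isInternal_restrict_finset A h s hs) fun i => hA i i.2

/-- `M = ⊕ i, A i` with the non-zero members inside a finset `s` has finite length iff every `A i`, `i ∈ s`, does.
[cite: BerrickKeating2000, Thm. 4.1.12 (i)] -/
theorem isFiniteLength_iff_of_isInternal_finset (h : DirectSum.IsInternal A) (s : Finset ι) (hs : ∀ i, A i ≠ ⊥ → i ∈ s) :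
    IsFiniteLength R M ↔ ∀ i ∈ s, IsFiniteLength R (A i) := by
  rw [isFiniteLength_iff_of_isInternal (fun i : s => A i) (isInternal_restrict_finset A h s hs)]
  exact ⟨fun H i hi => H ⟨i, hi⟩, fun H i => H i i.2⟩

/-- `ℓ(M) = Σ_{A i ≠ 0} ℓ(A i)` for an internal direct sum with finitely many non-zero members. [cite: BerrickKeating2000, Thm. 4.1.12 (ii)]
[cite: KnappVogan1995, App. A §3 Cor. A.27] -/
theorem length_eq_sum_of_isInternal_of_finite (h : DirectSum.IsInternal A) (hfin : {i | A i ≠ ⊥}.Finite) :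
    Module.length R M = ∑ i ∈ hfin.toFinset, Module.length R (A i) :=
  length_eq_sum_of_isInternal_finset A h hfin.toFinset fun _ hi => hfin.mem_toFinset.mpr hi

/-- `[M : S] = Σ_{A i ≠ 0} [A i : S]` for an internal direct sum with finitely many non-zero members, all of finite length.
[cite: BerrickKeating2000, Thm. 4.1.12 (ii)] [cite: KnappVogan1995, App. A §3 Cor. A.27] -/
theorem compMult_eq_sum_of_isInternal_of_finite (h : DirectSum.IsInternal A) (hfin : {i | A i ≠ ⊥}.Finite)
    (hA : ∀ i, IsFiniteLength R (A i)) : compMult R M S = ∑ i ∈ hfin.toFinset, compMult R (A i) S :=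
  compMult_eq_sum_of_isInternal_finset S A h hfin.toFinset (fun _ hi => hfin.mem_toFinset.mpr hi) fun i _ => hA i

omit [DecidableEq ι] in
/-- In a module of FINITE LENGTH an independent family of submodules has only finitely many non-zero members (Mathlib:
`Submodule.finite_ne_bot_of_iSupIndep` for Noetherian modules). [cite: BerrickKeating2000, Thm. 4.1.12 (i)] [cite: KnappVogan1995, App. A §3] -/
theorem finite_ne_bot_of_iSupIndep (hA : iSupIndep A) (hM : IsFiniteLength R M) : {i | A i ≠ ⊥}.Finite := by
  rw [isFiniteLength_iff_isNoetherian_isArtinian] at hM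
  obtain ⟨_, _⟩ := hM
  exact Submodule.finite_ne_bot_of_iSupIndep hA

/-- The non-zero members of an internal direct sum decomposition of a module of finite length are finite in number.
[cite: BerrickKeating2000, Thm. 4.1.12 (i)] -/
theorem finite_ne_bot_of_isInternal (h : DirectSum.IsInternal A) (hM : IsFiniteLength R M) : {i | A i ≠ ⊥}.Finite :=
  finite_ne_bot_of_iSupIndep A h.submodule_iSupIndep hM

/-- **`[M : S] = Σ_{A i ≠ 0} [A i : S]` for ANY internal direct sum decomposition of a module `M` of finite length** (the index type is
arbitrary; only finitely many members are non-zero). [cite: BerrickKeating2000, Thm. 4.1.12 (ii)] [cite: KnappVogan1995, App. A §3 Cor. A.27] -/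
theorem compMult_eq_sum_of_isInternal' (h : DirectSum.IsInternal A) (hM : IsFiniteLength R M) :
    compMult R M S = ∑ i ∈ (finite_ne_bot_of_isInternal A h hM).toFinset, compMult R (A i) S :=
  compMult_eq_sum_of_isInternal_of_finite S A h _ fun i => isFiniteLength_submodule (A i) hM

/-- **`ℓ(M) = Σ_{A i ≠ 0} ℓ(A i)` for any internal direct sum decomposition of a module of finite length.**
[cite: BerrickKeating2000, Thm. 4.1.12 (ii)] [cite: KnappVogan1995, App. A §3 Cor. A.27] -/
theorem length_eq_sum_of_isInternal' (h : DirectSum.IsInternal A) (hM : IsFiniteLength R M) :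
    Module.length R M = ∑ i ∈ (finite_ne_bot_of_isInternal A h hM).toFinset, Module.length R (A i) :=
  length_eq_sum_of_isInternal_of_finite A h _

omit [DecidableEq ι] in
/-- Each member of an internal direct sum decomposition of a module of finite length is counted: `[A i : S] ≤ [M : S]`.
[cite: BerrickKeating2000, Thm. 4.1.12 (ii)] -/
theorem compMult_le_of_isInternal (hM : IsFiniteLength R M) (i : ι) : compMult R (A i) S ≤ compMult R M S :=
  compMult_submodule_le S hM (A i)

/-! ## §4 The number of non-zero members is bounded by the length -/

omit [DecidableEq ι] in
/-- A non-zero submodule has length `≥ 1`. [cite: KnappVogan1995, App. A §3] -/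
theorem one_le_length_of_ne_bot {K : Submodule R M} (hK : K ≠ ⊥) : 1 ≤ Module.length R K := by
  rw [Order.one_le_iff_ne_zero, ne_eq, Module.length_eq_zero_iff, not_subsingleton_iff_nontrivial]
  exact Submodule.nontrivial_iff_ne_bot.mpr hK

/-- A non-zero module of finite length occurs: `[M : S] ≥ 1` for some simple `S`, hence `1 ≤ ℓ(K)` is the sharp bound used below;
in the presence of a decomposition, **the number of non-zero members of an internal direct sum decomposition `M = ⊕ i, A i` is at most
`ℓ(M)`** (finitely many non-zero members given as a finite set). [cite: BerrickKeating2000, Thm. 4.1.12 (ii)] [cite: KnappVogan1995, App. A §3 Cor. A.27] -/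
theorem card_toFinset_ne_bot_le_length (h : DirectSum.IsInternal A) (hfin : {i | A i ≠ ⊥}.Finite) :
    (hfin.toFinset.card : ℕ∞) ≤ Module.length R M := by
  rw [length_eq_sum_of_isInternal_of_finite A h hfin]
  calc (hfin.toFinset.card : ℕ∞) = ∑ _i ∈ hfin.toFinset, (1 : ℕ∞) := by rw [Finset.sum_const, nsmul_one]
    _ ≤ ∑ i ∈ hfin.toFinset, Module.length R (A i) :=
        Finset.sum_le_sum fun i hi => one_le_length_of_ne_bot (hfin.mem_toFinset.mp hi)

/-- The same for a module of finite length (its non-zero members are automatically finite in number).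
[cite: BerrickKeating2000, Thm. 4.1.12 (ii)] [cite: KnappVogan1995, App. A §3 Cor. A.27] -/
theorem card_toFinset_ne_bot_le_length' (h : DirectSum.IsInternal A) (hM : IsFiniteLength R M) :
    ((finite_ne_bot_of_isInternal A h hM).toFinset.card : ℕ∞) ≤ Module.length R M :=
  card_toFinset_ne_bot_le_length A h _

/-- Over a finite index type: the number of non-zero members is at most `ℓ(M)`. [cite: BerrickKeating2000, Thm. 4.1.12 (ii)] -/
theorem card_filter_ne_bot_le_length [Fintype ι] [DecidablePred fun i => A i ≠ ⊥] (h : DirectSum.IsInternal A) :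
    ((Finset.univ.filter fun i => A i ≠ ⊥).card : ℕ∞) ≤ Module.length R M := by
  have hfin : {i | A i ≠ ⊥}.Finite := Set.toFinite _
  have hs : (Finset.univ.filter fun i => A i ≠ ⊥) = hfin.toFinset := by
    ext i
    simp
  rw [hs]
  exact card_toFinset_ne_bot_le_length A h hfin

end Internal

end JordanHoelder

end Literature.Algebra.Module
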